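/-
Copyright (c) 2026 the pub-hodgecm-mathlib formalisation cell (harness21).  Prover seat hodgecm-mathlib-K2E3-p29 (g4), Track B ∕ R90-TF, h413 = `stmt-HodgeConjecture-24833`,
R90-TF section S8 «ContSpec-n½» (S8 dealer R90-CS-plan (g3) S8-R248 (5) «T-INSTANTIATION ROW», ruling «= (A)» S8-R250 (2)): FILE 2 of the row — THE EXPORTS-WITH-(E6) τ-ROW `hTEXP6`
OF PORTS.  ★ p864592 (exports WITH the truncated `L²` family, modulo row 1's GAUGE letters at the block) is composed with the two τ-PORTS (★ p864413 scalar port, ★ K2E2-p12 gauge port)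
exactly as ★ p864481 composed the (E6)-free head; the pure-type binders are discharged by ★ p864597 (FILE A port binders) as in ★ K2E1-p12's closed (E6)-free row; and the pieces are added
by ★ p865084 (FILE 1, truncation additivity).  Result: ★ p864638 §3's hypothesis `hTEXP6` at the `φ_ξ`-block from {`hμu`, the exports' frame, the ports' Haar frame, the restricted
co-weight line `hCO′`} — hence (R)′'s `hCONT` τ-row OFF the gauge road.
-/
import Summits.HodgeConjecture.HodgeConjecture.Theorems.R90S8ResGMidTruncatedExportsRowAdditiveU3   -- ★ p865084 FILE 1 (this seat): `truncatedExportsTauRow_of_pureBlocks`; brings ★ p864638 `hCONT_tauRow_of_truncatedExportsRow`, ★ p864592 (exports with (E6) modulo gauge letters)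
import Summits.HodgeConjecture.HodgeConjecture.Theorems.R90S8ResGMidRowsOfTauExportsClosedU3         -- ★ p864795 (K2E1-p12): the (E6)-free closed row's inputs — ★ p864597 FILE A port binders, ★ p864481 + the two τ-ports, ★ `isUnitary_blockChar`, ★ `hSUM_of_unitary`
import HarnessLib

/-!
# S8 (R)′ road, T-INSTANTIATION ROW, FILE 2 — `R90S8ResGMidTauExportsRowOfPortsU3`: THE EXPORTS-WITH-(E6) τ-ROW `hTEXP6` OF PORTS, AND (R)′'s `hCONT` τ-ROW OFF THE GAUGE ROAD

Track B ∕ R90-TF, crux h413 = `stmt-HodgeConjecture-24833`, route of record `HCCMUnconditional`; cell `hodgecm-mathlib`, R90-TF section S8 «ContSpec-n½ ∕ ResidualSpectrum», sub-socket (R)′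
(B ED. 7 :337) via ★ p864188 `res_midBlock_le_residual_of_tauAdmissible`, row `hCONT` (:77–:89) ← ★ p864638 §3 `hCONT_tauRow_of_truncatedExportsRow (hTEXP6)` ← `hTEXP6` (THIS FILE §3)
and K2E2-p12 (g10)'s (R)′ V2 OF RECORD (per-τ-generator binder `hTEXP6` = §3's conclusion).  THEOREMS ONLY (no `def`, no `instance`, no `notation`, no named-fact hypothesis, no `sorry`;
default heartbeats); lane `--supports stmt-HodgeConjecture-24833 --as helper` (count-neutral).  CLOSES NO SOCKET.  Pure COMPOSITION of ★ heads — no new mathematics.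

THE CHAIN (all ★ but the visible letters).  §1 = ★ p864592 `chiEisenstein_meromorphic_exports_kfinite_cm_three_of_gauge_letters_with_truncatedFamily` (the K-finite exports WITH (E6) modulo row 1's
gauge letters `hfam`∕`hnc` AT the block) with `hfam := hfam_gauge_of_scalars_cm_three … h12dCτ`, `hnc := hnc_gauge_of_scalars_cm_three … h12dCτ`, `h12dCτ :=` ★
`exists_integral_pureTensor_mul_flatSectionU_eq_tau` — ★ p864481's composition VERBATIM with the longer head (§1.1 with the slice LINE `hline`, §1.2 with the `z`-free CO-WEIGHT LINE via ★
`exists_line_of_coweightLine`).  §2 = ★ K2E1-p12 §4.1's pattern: at a ★ §5d pure block `V` at the τ-level `U₀` the pure-type binders of §1.2 are ★ FILE A's (`exists_isotypy_of_kMax_irreducible`,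
`exists_archBorelLaw`, `exists_GLlevel_of_isTauLevel`, `hVU_of_le_tauLevel`), the co-weight line is the RESTRICTED letter `hCO′` (irreducible finite-dimensional `K_∞`-stable `W₀` of CONTINUOUS
PAIR-SECTIONS of the block — the letter J-S8-CO (2)–(5) discharge, ★ p864934), and — the one difference with the (E6)-free row — the engine's Heisenberg package `(ν, 𝓕)` is THE ROW'S
per-generator package (Haar + inversion-invariant ⇒ right-invariant; `ν 𝓕 = 1 ≠ 0`), because (E6) truncates with it.  §3 = ★ FILE 1 `truncatedExportsTauRow_of_pureBlocks` ∘ §2 with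
`hχ₁u hχ₂u hsum` from `hμu` (★ `isUnitary_blockChar`, ★ `norm_eta∕psi_apply_eq_one`, ★ `hSUM_of_unitary`).  §4 = ★ p864638 §3 ∘ §3.
* §1 **`chiEisenstein_meromorphic_exports_kfinite_with_truncatedFamily_of_ports`**, **`…_of_ports_of_coweightLine`** — ★ p864481 §1∕§2 with (E6) appended (conclusion = ★ p864592's, BYTE FOR BYTE).
* §2 **`hPURE6_of_coweightLines'`** — FILE 1's pure-block letter `hPURE6` from {frame, ports' Haar frame, `hCO′`}.
* §3 **HEAD `hTEXP6_row_of_ports (hμu) (frame) (hCO′)`** ⊢ ★ p864638 §3's `hTEXP6` binder at `(ξ.bcη⁻¹·ξ.bcψ⁻¹·μω, ξ.ψ)` BYTE FOR BYTE (= K2E2-p12's (R)′ V2 per-generator binder).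
* §4 **`hCONT_tauRow_of_ports (hμu) (frame) (hCO′)`** ⊢ ★ p864188's `hCONT` binder (:77–:89) BYTE FOR BYTE — (R)′'s `hCONT` τ-row with NO gauge letter, NO ledger, NO Maass–Selberg letter.
THE BINDER LIST OF RECORD of §3∕§4 (= ★ K2E1-p12's (F)(F′)(U)(L′) minus the exports' own Heisenberg package, which the row quantifies): (F) `μ` + `νG β hβ μZ hμZ` with `[MeasurableSpace∕BorelSpace]`
on `G(𝔸)`, `G_∞`, `G(𝔸_f)`; (F′) the ports' auxiliary Haar frame `μa μf`; (U) `hμu : μω.IsUnitary`; (L′) `hCO′`.  The (E6)-free projection of §3 is ★ K2E1-p12's `exportsTauRow_closed′` (cited,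
not restated).
HONEST LABEL: HC_CM is proved only modulo the 7 printed citations (2 remaining named inputs: hLiu418 = `stmt-HodgeConjecture-24832`, h413 = `stmt-HodgeConjecture-24833`) until rung 0
closes; REL ≠ ★ ≠ BUILT; (R)′'s `hCONT` τ-row becomes ★ modulo (F)(F′)(U)(L′) — `hCO′` ★-able by J-S8-CO (5) ★ p864934; (R)′ :337 itself stays `sorry` in B ED. 7; pays no socket; count-neutral.

## References
* [BernsteinLapid2019] J. Bernstein, E. Lapid, *On the meromorphic continuation of Eisenstein series*, J. Amer. Math. Soc. 37 (2024), Thm 2.3, §4 Claim 1, §7.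
* [MoeglinWaldspurger1995] C. Mœglin, J.-L. Waldspurger, *Spectral Decomposition and Eisenstein Series* (1995), I.2.17, II.1.5–II.1.7, IV.1.8–IV.1.11, IV.2.3.
* [Knapp1986] A. W. Knapp, *Representation Theory of Semisimple Groups* (1986), VII §1–§2, VIII §3.
* [Bump1997] D. Bump, *Automorphic Forms and Representations* (1997), proof of Lemma 2.3.2.
* [Rogawski1990] J. D. Rogawski, *Automorphic Representations of Unitary Groups in Three Variables* (1990), §13.9 p. 229 (ii).
-/

set_option autoImplicit false
set_option linter.dupNamespace false  -- the mandated namespace `…HodgeConjecture.HodgeConjecture.R90.S8` (LEAD #1 L1) repeats the summit's segment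

noncomputable section

open MeasureTheory Measure Set Filter Topology NumberField IsDedekindDomain ContRepresentation
open Literature.NumberTheory Literature.NumberTheory.Automorphic Literature.NumberTheory.Automorphic.UnitaryGroup Literature.NumberTheory.GaloisRepresentations AdelicGroupData
open Literature.NumberTheory.Automorphic.Arthur2013.Leaves.TECR Literature.NumberTheory.Rogawski1990
open Summit.HodgeConjecture.HodgeConjecture.Cruxes.H413.K2E1BorelEisensteinU
open Summit.HodgeConjecture.HodgeConjecture.Cruxes.H413.K2E1CharacterEisensteinU2Defs
open Summit.HodgeConjecture.HodgeConjecture.Cruxes.H413.K2E1CharacterEisensteinU3PairDefs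
open Summit.HodgeConjecture.HodgeConjecture.Cruxes.H413.K2E1ChiSectionSpaceU3PairDefs
open Summit.HodgeConjecture.HodgeConjecture.Cruxes.H413.K2E1BLBorelSpacesU2Defs Summit.HodgeConjecture.HodgeConjecture.Cruxes.H413.K2E1BLBorelOperatorsU2Defs
open Summit.HodgeConjecture.HodgeConjecture.Cruxes.H413.K2E1ChiEisensteinMeromorphicExportsKFiniteWithTruncatedFamilyCMThree (chiEisenstein_meromorphic_exports_kfinite_cm_three_of_gauge_letters_with_truncatedFamily)
open Summit.HodgeConjecture.HodgeConjecture.Cruxes.H413.K2E1ChiGaugeSymbolTauCMThree (hfam_gauge_of_scalars_cm_three hnc_gauge_of_scalars_cm_three eq_zero_of_forall_K_eq_zero_of_isChiSectionPair_cm)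
open Summit.HodgeConjecture.HodgeConjecture.Cruxes.H413.K2E1ChiGaugeSymbolTauU3 (adelicVal_finAdelicToAdelic_mem_of_mem_glFiniteIntegralLevel)
open Summit.HodgeConjecture.HodgeConjecture.Cruxes.H413.K2E1ChiHeckeArchScalarTauU2 (exists_integral_pureTensor_mul_flatSectionU_eq_tau exists_line_of_coweightLine)
open Literature.MeasureTheory.Group
open scoped ENNReal NNReal

namespace Summit.HodgeConjecture.HodgeConjecture.R90.S8

/-! ## §1 The K-finite exports WITH (E6) at a pure-type block, both τ-ports plugged in (★ p864481's composition with ★ p864592's head) -/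

section Ports

variable (L : Type) [Field L] [NumberField L] [IsCMField L]
  [MeasurableSpace (quasiSplit (↥(maximalRealSubfield L)) L (IsCMField.complexConj L) 3).Adelic] [BorelSpace (quasiSplit (↥(maximalRealSubfield L)) L (IsCMField.complexConj L) 3).Adelic]
  [MeasurableSpace (arch (↥(maximalRealSubfield L)) L (IsCMField.complexConj L) 3 ((StdForm.antidiagonal 3).over L))] [BorelSpace (arch (↥(maximalRealSubfield L)) L (IsCMField.complexConj L) 3 ((StdForm.antidiagonal 3).over L))]
  [MeasurableSpace (finAdelic (↥(maximalRealSubfield L)) L (IsCMField.complexConj L) 3 ((StdForm.antidiagonal 3).over L))] [BorelSpace (finAdelic (↥(maximalRealSubfield L)) L (IsCMField.complexConj L) 3 ((StdForm.antidiagonal 3).over L))]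
  (μ : Measure (quasiSplit (↥(maximalRealSubfield L)) L (IsCMField.complexConj L) 3).automorphicQuotient) [(quasiSplit (↥(maximalRealSubfield L)) L (IsCMField.complexConj L) 3).IsAutomorphicMeasure μ]
  (νG : Measure (quasiSplit (↥(maximalRealSubfield L)) L (IsCMField.complexConj L) 3).Adelic) [νG.IsHaarMeasure] [νG.IsInvInvariant] [SFinite νG]
  (ν : Measure ↥(adelicUnipotent (↥(maximalRealSubfield L)) L (IsCMField.complexConj L) 3)) [ν.IsHaarMeasure] [ν.IsMulRightInvariant] [ν.IsInvInvariant]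
  {𝓕 : Set ↥(adelicUnipotent (↥(maximalRealSubfield L)) L (IsCMField.complexConj L) 3)}
  (h𝓕N : IsFundamentalDomain ↥(rationalUnipotent (↥(maximalRealSubfield L)) L (IsCMField.complexConj L) 3) 𝓕 ν) (h𝓕c : IsCompact (closure 𝓕)) (h𝓕₀ : ν 𝓕 ≠ 0)
  {β : (quasiSplit (↥(maximalRealSubfield L)) L (IsCMField.complexConj L) 3).Adelic → ℝ≥0∞}
  (hβ : IsCoveringWeight ↥((arithmeticBorel (↥(maximalRealSubfield L)) L (IsCMField.complexConj L) 3).map (quasiSplit (↥(maximalRealSubfield L)) L (IsCMField.complexConj L) 3).arithmeticSubgroup.subtype) β)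
  {μZ : Measure (borelQuotient (↥(maximalRealSubfield L)) L (IsCMField.complexConj L) 3)} [SFinite μZ]
  (hμZ : ∀ f : borelQuotient (↥(maximalRealSubfield L)) L (IsCMField.complexConj L) 3 → ℝ≥0∞, Measurable f → ∫⁻ z, f z ∂μZ = ∫⁻ g, β g * f (toBorelQuotient (↥(maximalRealSubfield L)) L (IsCMField.complexConj L) 3 g) ∂νG)
  -- auxiliary Haar measures on `G_∞` (two-sided) and `G(𝔸_f)` (they only enter the proofs of the ports)
  (μa : Measure (arch (↥(maximalRealSubfield L)) L (IsCMField.complexConj L) 3 ((StdForm.antidiagonal 3).over L))) [μa.IsHaarMeasure] [μa.IsMulRightInvariant]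
  (μf : Measure (finAdelic (↥(maximalRealSubfield L)) L (IsCMField.complexConj L) 3 ((StdForm.antidiagonal 3).over L))) [μf.IsHaarMeasure]
  -- the PURE-TYPE K-FINITE BLOCK: finite-dimensional, `K_max`-stable, continuous bounded `(χ₁, χ₂)`-pair-sections, `χ₂` automorphic (★ T head's block binders)
  {χ₁ : HeckeCharacter L} {χ₂ : ↥(TorusDict.torus (IsCMField.complexConj L)) →ₜ* ℂˣ} (hχ₂ : TorusDict.IsAutomorphic (IsCMField.complexConj L) χ₂)
  (V : Submodule ℂ ((quasiSplit (↥(maximalRealSubfield L)) L (IsCMField.complexConj L) 3).Adelic → ℂ)) [FiniteDimensional ℂ ↥V]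
  (hVK : ∀ k ∈ ((standardMaximalCompactGL 3 L).comap (adelicVal (↥(maximalRealSubfield L)) L (IsCMField.complexConj L) 3 ((StdForm.antidiagonal 3).over L)) : Subgroup (quasiSplit (↥(maximalRealSubfield L)) L (IsCMField.complexConj L) 3).Adelic), ∀ ψ ∈ V, (fun x => ψ (x * k)) ∈ V)
  (hVχ : ∀ ψ ∈ V, IsChiSectionPair χ₁ χ₂ ψ) (hVc : ∀ ψ ∈ V, Continuous ψ) (hVM : ∀ ψ ∈ V, ∃ M : ℝ, ∀ x, ‖ψ x‖ ≤ M)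
  -- the LEVEL `U₀ ≤ GL₃(𝒪̂)` (open compact) under which `V` is right-invariant (★ gauge port's binders)
  (U₀ : Subgroup (GL (Fin 3) (FiniteAdeleRing (𝓞 L) L))) (hU₀o : IsOpen (U₀ : Set (GL (Fin 3) (FiniteAdeleRing (𝓞 L) L)))) (hU₀c : IsCompact (U₀ : Set (GL (Fin 3) (FiniteAdeleRing (𝓞 L) L))))
  (hU₀K : U₀ ≤ glFiniteIntegralLevel 3 L)
  (hVU : ∀ φ ∈ V, ∀ b : finAdelic (↥(maximalRealSubfield L)) L (IsCMField.complexConj L) 3 ((StdForm.antidiagonal 3).over L), (b : GL (Fin 3) (FiniteAdeleRing (𝓞 L) L)) ∈ U₀ →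
    ∀ y : (quasiSplit (↥(maximalRealSubfield L)) L (IsCMField.complexConj L) 3).Adelic, φ (y * finAdelicToAdelic (↥(maximalRealSubfield L)) L (IsCMField.complexConj L) 3 ((StdForm.antidiagonal 3).over L) b) = φ y)
  -- the PURE-TYPE LETTERS (★ scalar port's binders): a `K_∞`-type `(W, τ)`, the archimedean left law `cB z` of the flat sections of `V` along `B_∞`, the `W`-isotypy of `V`
  {W : Type*} [AddCommGroup W] [Module ℂ W] (τ : arch (↥(maximalRealSubfield L)) L (IsCMField.complexConj L) 3 ((StdForm.antidiagonal 3).over L) → W →ₗ[ℂ] W)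
  (cB : ℂ → arch (↥(maximalRealSubfield L)) L (IsCMField.complexConj L) 3 ((StdForm.antidiagonal 3).over L) → ℂ)
  (hVB : ∀ (z : ℂ), ∀ φ ∈ V, ∀ b ∈ (borelAdelic (↥(maximalRealSubfield L)) L (IsCMField.complexConj L) 3).comap (archToAdelic (↥(maximalRealSubfield L)) L (IsCMField.complexConj L) 3 ((StdForm.antidiagonal 3).over L)),
    ∀ (a : arch (↥(maximalRealSubfield L)) L (IsCMField.complexConj L) 3 ((StdForm.antidiagonal 3).over L)) (xf : finAdelic (↥(maximalRealSubfield L)) L (IsCMField.complexConj L) 3 ((StdForm.antidiagonal 3).over L)),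
      flatSectionU φ z (archToAdelic (↥(maximalRealSubfield L)) L (IsCMField.complexConj L) 3 _ (b * a) * finAdelicToAdelic (↥(maximalRealSubfield L)) L (IsCMField.complexConj L) 3 _ xf) =
        cB z b * flatSectionU φ z (archToAdelic (↥(maximalRealSubfield L)) L (IsCMField.complexConj L) 3 _ a * finAdelicToAdelic (↥(maximalRealSubfield L)) L (IsCMField.complexConj L) 3 _ xf))
  (hVτ : V ≤ ⨆ (J : W →ₗ[ℂ] ((quasiSplit (↥(maximalRealSubfield L)) L (IsCMField.complexConj L) 3).Adelic → ℂ)) (_ : LinearMap.range J ≤ V ∧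
    ∀ k ∈ (((standardMaximalCompactGL 3 L).comap (adelicVal (↥(maximalRealSubfield L)) L (IsCMField.complexConj L) 3 ((StdForm.antidiagonal 3).over L))).comap
        (archToAdelic (↥(maximalRealSubfield L)) L (IsCMField.complexConj L) 3 ((StdForm.antidiagonal 3).over L))),
      ∀ (v : W) (x : (quasiSplit (↥(maximalRealSubfield L)) L (IsCMField.complexConj L) 3).Adelic), J v (x * archToAdelic (↥(maximalRealSubfield L)) L (IsCMField.complexConj L) 3 _ k) = J (τ k v) x), LinearMap.range J)


include μ h𝓕N h𝓕c h𝓕₀ hβ hμZ μa μf hχ₂ hVK hVχ hVc hVM hU₀o hU₀c hU₀K hVU hVB hVτ in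
/-- **§1.1 — THE `χ`-EISENSTEIN EXPORTS WITH BOUND AND WITH (E6) AT A PURE-TYPE K-FINITE BLOCK, BOTH τ-PORTS PLUGGED IN**: ★ p864592
`chiEisenstein_meromorphic_exports_kfinite_cm_three_of_gauge_letters_with_truncatedFamily` with `hfam := hfam_gauge_of_scalars_cm_three … h12dCτ`, `hnc := hnc_gauge_of_scalars_cm_three … h12dCτ`,
`h12dCτ :=` ★ `exists_integral_pureTensor_mul_flatSectionU_eq_tau` (`U := U₀ ∩ G_f`) — ★ p864481 §1's composition VERBATIM with the longer head; visible pure-type letter: THE LINE `hline z`.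
Conclusion = ★ p864592's, byte for byte ((E1)–(E4), (E2-bd), (E6)). [cite: BernsteinLapid2019, Thm 2.3, §4 Claim 1, §7] [cite: MoeglinWaldspurger1995, II.1.7, IV.1.8–IV.1.11, IV.2.3]
[cite: Knapp1986, VII §1–§2] [cite: Bump1997, proof of Lemma 2.3.2] -/
theorem chiEisenstein_meromorphic_exports_kfinite_with_truncatedFamily_of_ports
    (hline : ∀ z : ℂ, ∃ j₀ : W →ₗ[ℂ] (arch (↥(maximalRealSubfield L)) L (IsCMField.complexConj L) 3 ((StdForm.antidiagonal 3).over L) → ℂ),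
      ∀ j : W →ₗ[ℂ] (arch (↥(maximalRealSubfield L)) L (IsCMField.complexConj L) 3 ((StdForm.antidiagonal 3).over L) → ℂ),
        (∀ w, ∀ b ∈ (borelAdelic (↥(maximalRealSubfield L)) L (IsCMField.complexConj L) 3).comap (archToAdelic (↥(maximalRealSubfield L)) L (IsCMField.complexConj L) 3 ((StdForm.antidiagonal 3).over L)),
          ∀ g, j w (b * g) = cB z b * j w g) →
        (∀ k ∈ (((standardMaximalCompactGL 3 L).comap (adelicVal (↥(maximalRealSubfield L)) L (IsCMField.complexConj L) 3 ((StdForm.antidiagonal 3).over L))).comap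
            (archToAdelic (↥(maximalRealSubfield L)) L (IsCMField.complexConj L) 3 ((StdForm.antidiagonal 3).over L))),
          ∀ (w : W) (g : arch (↥(maximalRealSubfield L)) L (IsCMField.complexConj L) 3 ((StdForm.antidiagonal 3).over L)), j w (g * k) = j (τ k w) g) → ∃ a : ℂ, j = a • j₀)
    {φ : (quasiSplit (↥(maximalRealSubfield L)) L (IsCMField.complexConj L) 3).Adelic → ℂ} (hφ : φ ∈ V) :
    ∃ (n : ℕ) (φ' : Fin n → (quasiSplit (↥(maximalRealSubfield L)) L (IsCMField.complexConj L) 3).Adelic → ℂ) (q : Fin n → ℂ → ℂ) (Ec : ℂ → (quasiSplit (↥(maximalRealSubfield L)) L (IsCMField.complexConj L) 3).Adelic → ℂ) (qc : Fin n → ℂ → ℂ) (P : Set ℂ),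
      -- the columns (★ (b′)) and the scattering coordinates (★ 7c)
      LinearIndependent ℂ φ' ∧ (∀ j, IsChiSectionPair (reflectChar (IsCMField.complexConj L) χ₁) χ₂ (φ' j)) ∧ (∀ j, Continuous (φ' j)) ∧ (∃ Mb : ℝ, ∀ j x, ‖φ' j x‖ ≤ Mb) ∧
      (∀ j, DifferentiableOn ℂ (q j) {z : ℂ | 2 < z.re}) ∧
      (∀ z : ℂ, 2 < z.re → (∑ j, q j z • φ' j) = ((((ν 𝓕).toReal⁻¹ : ℝ)) : ℂ) • (fun g : (quasiSplit (↥(maximalRealSubfield L)) L (IsCMField.complexConj L) 3).Adelic => (∫ v : ↥(adelicUnipotent (↥(maximalRealSubfield L)) L (IsCMField.complexConj L) 3), flatSectionU φ z ((quasiSplit (↥(maximalRealSubfield L)) L (IsCMField.complexConj L) 3).toAdelic (weylLongU ((IsCMField.complexConj L : L ≃ₐ[↥(maximalRealSubfield L)] L) : L →+* L) (rfl : (StdForm.antidiagonal 3).over L = (StdForm.antidiagonal 3).over L)) * ((v : (quasiSplit (↥(maximalRealSubfield L)) L (IsCMField.complexConj L) 3).Adelic) * g)) ∂ν) * (((borelHeight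 g : ℝ) : ℂ) ^ (z - 2)))) ∧
      -- ★ with-bound's clause list: (E1) normal forms, tube identity, `qc = q` on `{2 < Re}`, the pole set, analyticity ∕ holomorphy off `P`, (E4), (E2-bd)
      ((∀ g, MeromorphicNFOn (fun z => Ec z g) univ) ∧ (∀ j, MeromorphicNFOn (qc j) univ) ∧
      (∀ z : ℂ, 2 < z.re → Ec z = eisensteinSeriesU (flatSectionU φ z)) ∧ (∀ j (z : ℂ), 2 < z.re → qc j z = q j z) ∧
      IsClosed P ∧ (∀ z₀ : ℂ, ∀ᶠ s in 𝓝[≠] z₀, s ∉ P) ∧ (∀ z ∈ P, z.re ≤ 2) ∧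
      (∀ g (z : ℂ), z ∉ P → AnalyticAt ℂ (fun z => Ec z g) z) ∧ (∀ j (z : ℂ), z ∉ P → AnalyticAt ℂ (qc j) z) ∧
      (∀ g, DifferentiableOn ℂ (fun z => Ec z g) Pᶜ) ∧ (∀ j, DifferentiableOn ℂ (qc j) Pᶜ) ∧
      (∀ z : ℂ, z ∉ P → Continuous (Ec z)) ∧
      -- (E2-bd) THE JOINT LOCAL BOUND off `P`
      (∀ z₁ : ℂ, z₁ ∉ P → ∀ K : Set (quasiSplit (↥(maximalRealSubfield L)) L (IsCMField.complexConj L) 3).Adelic, IsCompact K → ∃ V ∈ 𝓝 z₁, ∃ M : ℝ, ∀ z ∈ V, ∀ g ∈ K, ‖Ec z g‖ ≤ M) ∧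
      -- (E6) THE TRUNCATED CONTINUED FAMILY IS `L²`-HOLOMORPHIC OFF `P`, AT EVERY LEVEL `T ≥ 1`
      (∀ T : ℝ≥0, 1 ≤ T → ∃ Fam : ℂ → Lp ℂ 2 μ, DifferentiableOn ℂ Fam Pᶜ ∧
        ∀ z : ℂ, z ∉ P → ((Fam z : Lp ℂ 2 μ) : (quasiSplit (↥(maximalRealSubfield L)) L (IsCMField.complexConj L) 3).automorphicQuotient → ℂ) =ᵐ[μ]
          (quasiSplit (↥(maximalRealSubfield L)) L (IsCMField.complexConj L) 3).quotFun (truncation ν 𝓕 T (Ec z)))) := by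
  -- «vanishing on `K_max` ⇒ `0`» for the members of `V` (pair-sections, CM Iwasawa)
  have hVK₀ : ∀ ψ ∈ V, (∀ k : (quasiSplit (↥(maximalRealSubfield L)) L (IsCMField.complexConj L) 3).Adelic,
      adelicVal (↥(maximalRealSubfield L)) L (IsCMField.complexConj L) 3 ((StdForm.antidiagonal 3).over L) k ∈ standardMaximalCompactGL 3 L → ψ k = 0) → ψ = 0 :=
    fun ψ hψ h0 => eq_zero_of_forall_K_eq_zero_of_isChiSectionPair_cm L (hVχ ψ hψ) h0
  -- the level `U := U₀ ∩ G_f` as a set of `G(𝔸_f)`: inside `K`, and `V` is right-invariant under it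
  have hUK : ∀ b ∈ ((U₀.subgroupOf (finAdelic (↥(maximalRealSubfield L)) L (IsCMField.complexConj L) 3 ((StdForm.antidiagonal 3).over L)) : Subgroup _) :
      Set (finAdelic (↥(maximalRealSubfield L)) L (IsCMField.complexConj L) 3 ((StdForm.antidiagonal 3).over L))),
      adelicVal (↥(maximalRealSubfield L)) L (IsCMField.complexConj L) 3 ((StdForm.antidiagonal 3).over L)
        (finAdelicToAdelic (↥(maximalRealSubfield L)) L (IsCMField.complexConj L) 3 _ b) ∈ standardMaximalCompactGL 3 L :=
    fun b hb => adelicVal_finAdelicToAdelic_mem_of_mem_glFiniteIntegralLevel (hU₀K (Subgroup.mem_subgroupOf.1 hb))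
  have hVU' : ∀ ψ ∈ V, ∀ b ∈ ((U₀.subgroupOf (finAdelic (↥(maximalRealSubfield L)) L (IsCMField.complexConj L) 3 ((StdForm.antidiagonal 3).over L)) : Subgroup _) :
      Set (finAdelic (↥(maximalRealSubfield L)) L (IsCMField.complexConj L) 3 ((StdForm.antidiagonal 3).over L))),
      ∀ x : (quasiSplit (↥(maximalRealSubfield L)) L (IsCMField.complexConj L) 3).Adelic, ψ (x * finAdelicToAdelic (↥(maximalRealSubfield L)) L (IsCMField.complexConj L) 3 _ b) = ψ x :=
    fun ψ hψ b hb x => hVU ψ hψ b (Subgroup.mem_subgroupOf.1 hb) x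
  exact chiEisenstein_meromorphic_exports_kfinite_cm_three_of_gauge_letters_with_truncatedFamily L μ νG ν h𝓕N h𝓕c h𝓕₀ hβ hμZ hχ₂ V hVK hVχ hVc hVM
    (hfam_gauge_of_scalars_cm_three L νG μa μf U₀ hU₀o hU₀c hU₀K V hVc hVU hVK₀ fun h hinf hh hhs hten hcent z =>
      exists_integral_pureTensor_mul_flatSectionU_eq_tau νG μa μf V hVc hUK hVU' τ cB hVB hVτ hline hh hhs hten hcent z)
    (hnc_gauge_of_scalars_cm_three L νG μa μf U₀ hU₀o hU₀c hU₀K V hVc hVU hVK₀ fun h hinf hh hhs hten hcent z =>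
      exists_integral_pureTensor_mul_flatSectionU_eq_tau νG μa μf V hVc hUK hVU' τ cB hVB hVτ hline hh hhs hten hcent z)
    hφ

include μ h𝓕N h𝓕c h𝓕₀ hβ hμZ μa μf hχ₂ hVK hVχ hVc hVM hU₀o hU₀c hU₀K hVU hVB hVτ in
/-- **§1.2 — THE SAME FROM THE `z`-FREE CO-WEIGHT LINE** (`χM` on `G_∞` agreeing with every `cB z` on `M_∞`, `hcBM`; the CO-WEIGHT LINE `hco`): ★ p864481 §2's reduction VERBATIM (★
`exists_line_of_coweightLine` with the CM arch Iwasawa, ★ `IsCMField.complexConj_ne_one`, ★ `complexConj_smul_infinitePlace`). [cite: Knapp1986, VII §1–§2, VIII §3]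
[cite: BernsteinLapid2019, Thm 2.3, §4 Claim 1] [cite: MoeglinWaldspurger1995, II.1.7, IV.1.8–IV.1.11, IV.2.3] -/
theorem chiEisenstein_meromorphic_exports_kfinite_with_truncatedFamily_of_ports_of_coweightLine
    (χM : arch (↥(maximalRealSubfield L)) L (IsCMField.complexConj L) 3 ((StdForm.antidiagonal 3).over L) → ℂ)
    (hcBM : ∀ (z : ℂ), ∀ m ∈ (borelAdelic (↥(maximalRealSubfield L)) L (IsCMField.complexConj L) 3).comap (archToAdelic (↥(maximalRealSubfield L)) L (IsCMField.complexConj L) 3 ((StdForm.antidiagonal 3).over L)),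
      m ∈ (((standardMaximalCompactGL 3 L).comap (adelicVal (↥(maximalRealSubfield L)) L (IsCMField.complexConj L) 3 ((StdForm.antidiagonal 3).over L))).comap
        (archToAdelic (↥(maximalRealSubfield L)) L (IsCMField.complexConj L) 3 ((StdForm.antidiagonal 3).over L))) → cB z m = χM m)
    (hco : ∃ l₀ : W →ₗ[ℂ] ℂ, ∀ l : W →ₗ[ℂ] ℂ,
      (∀ m ∈ (borelAdelic (↥(maximalRealSubfield L)) L (IsCMField.complexConj L) 3).comap (archToAdelic (↥(maximalRealSubfield L)) L (IsCMField.complexConj L) 3 ((StdForm.antidiagonal 3).over L)),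
        m ∈ (((standardMaximalCompactGL 3 L).comap (adelicVal (↥(maximalRealSubfield L)) L (IsCMField.complexConj L) 3 ((StdForm.antidiagonal 3).over L))).comap
          (archToAdelic (↥(maximalRealSubfield L)) L (IsCMField.complexConj L) 3 ((StdForm.antidiagonal 3).over L))) → ∀ w, l (τ m w) = χM m * l w) → ∃ a : ℂ, l = a • l₀)
    {φ : (quasiSplit (↥(maximalRealSubfield L)) L (IsCMField.complexConj L) 3).Adelic → ℂ} (hφ : φ ∈ V) :
    ∃ (n : ℕ) (φ' : Fin n → (quasiSplit (↥(maximalRealSubfield L)) L (IsCMField.complexConj L) 3).Adelic → ℂ) (q : Fin n → ℂ → ℂ) (Ec : ℂ → (quasiSplit (↥(maximalRealSubfield L)) L (IsCMField.complexConj L) 3).Adelic → ℂ) (qc : Fin n → ℂ → ℂ) (P : Set ℂ),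
      -- the columns (★ (b′)) and the scattering coordinates (★ 7c)
      LinearIndependent ℂ φ' ∧ (∀ j, IsChiSectionPair (reflectChar (IsCMField.complexConj L) χ₁) χ₂ (φ' j)) ∧ (∀ j, Continuous (φ' j)) ∧ (∃ Mb : ℝ, ∀ j x, ‖φ' j x‖ ≤ Mb) ∧
      (∀ j, DifferentiableOn ℂ (q j) {z : ℂ | 2 < z.re}) ∧
      (∀ z : ℂ, 2 < z.re → (∑ j, q j z • φ' j) = ((((ν 𝓕).toReal⁻¹ : ℝ)) : ℂ) • (fun g : (quasiSplit (↥(maximalRealSubfield L)) L (IsCMField.complexConj L) 3).Adelic => (∫ v : ↥(adelicUnipotent (↥(maximalRealSubfield L)) L (IsCMField.complexConj L) 3), flatSectionU φ z ((quasiSplit (↥(maximalRealSubfield L)) L (IsCMField.complexConj L) 3).toAdelic (weylLongU ((IsCMField.complexConj L : L ≃ₐ[↥(maximalRealSubfield L)] L) : L →+* L) (rfl : (StdForm.antidiagonal 3).over L = (StdForm.antidiagonal 3).over L)) * ((v : (quasiSplit (↥(maximalRealSubfield L)) L (IsCMField.complexConj L) 3).Adelic) * g)) ∂ν) * (((borelHeight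 g : ℝ) : ℂ) ^ (z - 2)))) ∧
      -- ★ with-bound's clause list: (E1) normal forms, tube identity, `qc = q` on `{2 < Re}`, the pole set, analyticity ∕ holomorphy off `P`, (E4), (E2-bd)
      ((∀ g, MeromorphicNFOn (fun z => Ec z g) univ) ∧ (∀ j, MeromorphicNFOn (qc j) univ) ∧
      (∀ z : ℂ, 2 < z.re → Ec z = eisensteinSeriesU (flatSectionU φ z)) ∧ (∀ j (z : ℂ), 2 < z.re → qc j z = q j z) ∧
      IsClosed P ∧ (∀ z₀ : ℂ, ∀ᶠ s in 𝓝[≠] z₀, s ∉ P) ∧ (∀ z ∈ P, z.re ≤ 2) ∧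
      (∀ g (z : ℂ), z ∉ P → AnalyticAt ℂ (fun z => Ec z g) z) ∧ (∀ j (z : ℂ), z ∉ P → AnalyticAt ℂ (qc j) z) ∧
      (∀ g, DifferentiableOn ℂ (fun z => Ec z g) Pᶜ) ∧ (∀ j, DifferentiableOn ℂ (qc j) Pᶜ) ∧
      (∀ z : ℂ, z ∉ P → Continuous (Ec z)) ∧
      -- (E2-bd) THE JOINT LOCAL BOUND off `P`
      (∀ z₁ : ℂ, z₁ ∉ P → ∀ K : Set (quasiSplit (↥(maximalRealSubfield L)) L (IsCMField.complexConj L) 3).Adelic, IsCompact K → ∃ V ∈ 𝓝 z₁, ∃ M : ℝ, ∀ z ∈ V, ∀ g ∈ K, ‖Ec z g‖ ≤ M) ∧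
      -- (E6) THE TRUNCATED CONTINUED FAMILY IS `L²`-HOLOMORPHIC OFF `P`, AT EVERY LEVEL `T ≥ 1`
      (∀ T : ℝ≥0, 1 ≤ T → ∃ Fam : ℂ → Lp ℂ 2 μ, DifferentiableOn ℂ Fam Pᶜ ∧
        ∀ z : ℂ, z ∉ P → ((Fam z : Lp ℂ 2 μ) : (quasiSplit (↥(maximalRealSubfield L)) L (IsCMField.complexConj L) 3).automorphicQuotient → ℂ) =ᵐ[μ]
          (quasiSplit (↥(maximalRealSubfield L)) L (IsCMField.complexConj L) 3).quotFun (truncation ν 𝓕 T (Ec z)))) := by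
  refine chiEisenstein_meromorphic_exports_kfinite_with_truncatedFamily_of_ports L μ νG ν h𝓕N h𝓕c h𝓕₀ hβ hμZ μa μf hχ₂ V hVK hVχ hVc hVM U₀ hU₀o hU₀c hU₀K hVU τ cB hVB hVτ (fun z => ?_) hφ
  obtain ⟨l₀, hl₀⟩ := hco
  exact exists_line_of_coweightLine _ _ (cB z) τ
    (Summit.HodgeConjecture.HodgeConjecture.Cruxes.H413.K2E1ChiHeckeArchScalarU2.exists_mem_comap_borel_mul_mem_comap_K_arch (IsCMField.complexConj_ne_one L) (complexConj_smul_infinitePlace L))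
    ⟨l₀, fun l hl => hl₀ l fun m hmB hmK w => by rw [← hcBM z m hmB hmK]; exact hl m hmB hmK w⟩

end Ports

/-! ## §2 FILE 1's pure-block letter `hPURE6` from the frame, the ports' Haar frame and the restricted co-weight line `hCO′` -/

section Row

variable (L : Type) [Field L] [NumberField L] [IsCMField L]
  [MeasurableSpace (quasiSplit (↥(maximalRealSubfield L)) L (IsCMField.complexConj L) 3).Adelic] [BorelSpace (quasiSplit (↥(maximalRealSubfield L)) L (IsCMField.complexConj L) 3).Adelic]
  [MeasurableSpace ↥(arch (↥(maximalRealSubfield L)) L (IsCMField.complexConj L) 3 ((StdForm.antidiagonal 3).over L))] [BorelSpace ↥(arch (↥(maximalRealSubfield L)) L (IsCMField.complexConj L) 3 ((StdForm.antidiagonal 3).over L))] [MeasurableSpace ↥(finAdelic (↥(maximalRealSubfield L)) L (IsCMField.complexConj L) 3 ((StdForm.antidiagonal 3).over L))] [BorelSpace ↥(finAdelic (↥(maximalRealSubfield L)) L (IsCMField.complexConj L) 3 ((StdForm.antidiagonal 3).over L))]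
  (μ : Measure (quasiSplit (↥(maximalRealSubfield L)) L (IsCMField.complexConj L) 3).automorphicQuotient) [(quasiSplit (↥(maximalRealSubfield L)) L (IsCMField.complexConj L) 3).IsAutomorphicMeasure μ]
  (νG : Measure (quasiSplit (↥(maximalRealSubfield L)) L (IsCMField.complexConj L) 3).Adelic) [νG.IsHaarMeasure] [νG.IsInvInvariant] [SFinite νG]
  {β : (quasiSplit (↥(maximalRealSubfield L)) L (IsCMField.complexConj L) 3).Adelic → ℝ≥0∞}
  (hβ : IsCoveringWeight ↥((arithmeticBorel (↥(maximalRealSubfield L)) L (IsCMField.complexConj L) 3).map (quasiSplit (↥(maximalRealSubfield L)) L (IsCMField.complexConj L) 3).arithmeticSubgroup.subtype) β)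
  {μZ : Measure (borelQuotient (↥(maximalRealSubfield L)) L (IsCMField.complexConj L) 3)} [SFinite μZ]
  (hμZ : ∀ f : borelQuotient (↥(maximalRealSubfield L)) L (IsCMField.complexConj L) 3 → ℝ≥0∞, Measurable f → ∫⁻ z, f z ∂μZ = ∫⁻ g, β g * f (toBorelQuotient (↥(maximalRealSubfield L)) L (IsCMField.complexConj L) 3 g) ∂νG)
  (μa : Measure ↥(arch (↥(maximalRealSubfield L)) L (IsCMField.complexConj L) 3 ((StdForm.antidiagonal 3).over L))) [μa.IsHaarMeasure] [μa.IsMulRightInvariant]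
  (μf : Measure ↥(finAdelic (↥(maximalRealSubfield L)) L (IsCMField.complexConj L) 3 ((StdForm.antidiagonal 3).over L))) [μf.IsHaarMeasure]
  (ξ : OneDimAutRepH L) (μω : HeckeCharacter L)

include hβ hμZ μa μf in
/-- **§2 — `hPURE6_of_coweightLines'`**: ★ FILE 1's PURE-BLOCK EXPORTS-WITH-(E6) LETTER `hPURE6` (exports-with-(E6) datum for every section of every ★ §5d pure block, for every normalised
Heisenberg package) from §1.2 with `hVτ`, `cB`∕`hVB`∕`χM := cB 0`∕`hcBM`, `U₀′`∕`hVU` supplied by ★ FILE A p864597, `hχ₂ := ξ.hψ`, the co-weight line by the RESTRICTED letter `hCO′` (members of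
`W₀ ≤ V` are continuous pair-sections), and the engine run on THE ROW'S package `(ν, 𝓕)` (Haar + inversion-invariant ⇒ right-invariant; `ν 𝓕 = 1 ≠ 0`) — ★ K2E1-p12 §4.1's proof with §1.2 in
place of ★ p864481 §2. [cite: BernsteinLapid2019, Thm 2.3, §4] [cite: MoeglinWaldspurger1995, IV.1.8–IV.1.11, IV.2.3] [cite: Knapp1986, VII §1–§2] -/
theorem hPURE6_of_coweightLines'
    (hCO : ∀ (W₀ : Submodule ℂ ((quasiSplit (↥(maximalRealSubfield L)) L (IsCMField.complexConj L) 3).Adelic → ℂ)) (hW₀K : ∀ k : ↥(archMaximalCompact L), ∀ ψ ∈ W₀, ((rightTranslation (quasiSplit (↥(maximalRealSubfield L)) L (IsCMField.complexConj L) 3)).comp (archMaximalCompact L).subtype) k ψ ∈ W₀) (_ : FiniteDimensional ℂ ↥W₀)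
      (_ : ∀ ψ ∈ W₀, IsChiSectionPair (ξ.bcη⁻¹ * ξ.bcψ⁻¹ * μω) ξ.ψ ψ) (_ : ∀ ψ ∈ W₀, Continuous ψ) (_ : (Subrepresentation.toRepresentation (⟨W₀, hW₀K⟩ : Subrepresentation ((rightTranslation (quasiSplit (↥(maximalRealSubfield L)) L (IsCMField.complexConj L) 3)).comp (archMaximalCompact L).subtype))).IsIrreducible),
      ∃ l₀ : ↥W₀ →ₗ[ℂ] ℂ, ∀ l : ↥W₀ →ₗ[ℂ] ℂ,
        (∀ (m : ↥(arch (↥(maximalRealSubfield L)) L (IsCMField.complexConj L) 3 ((StdForm.antidiagonal 3).over L))) (hmB : (archToAdelic (↥(maximalRealSubfield L)) L (IsCMField.complexConj L) 3 ((StdForm.antidiagonal 3).over L)) m ∈ borelAdelic (↥(maximalRealSubfield L)) L (IsCMField.complexConj L) 3) (hmK : (adelicVal (↥(maximalRealSubfield L)) L (IsCMField.complexConj L) 3 ((StdForm.antidiagonal 3).over L)) ((archToAdelic (↥(maximalRealSubfield L)) L (IsCMField.complexConj L) 3 ((StdForm.antidiagonal 3).over L)) m) ∈ standardMaximalCompactGL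 3 L) (w : ↥W₀),
          l ((Subrepresentation.toRepresentation (⟨W₀, hW₀K⟩ : Subrepresentation ((rightTranslation (quasiSplit (↥(maximalRealSubfield L)) L (IsCMField.complexConj L) 3)).comp (archMaximalCompact L).subtype))) ⟨(archToAdelic (↥(maximalRealSubfield L)) L (IsCMField.complexConj L) 3 ((StdForm.antidiagonal 3).over L)) m, archToAdelic_mem_archMaximalCompact L m hmK⟩ w) = ((((ξ.bcη⁻¹ * ξ.bcψ⁻¹ * μω)) (firstEntryUnit hmB) : ℂˣ) : ℂ) * (((ξ.ψ) (middleEntryUnitary hmB) : ℂˣ) : ℂ) * l w) →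
        ∃ a : ℂ, l = a • l₀) :
    ∀ (U₀ : Subgroup ↥(finAdelic (↥(maximalRealSubfield L)) L (IsCMField.complexConj L) 3 ((StdForm.antidiagonal 3).over L))) (_ : IsTauLevel L U₀) (V : Submodule ℂ ((quasiSplit (↥(maximalRealSubfield L)) L (IsCMField.complexConj L) 3).Adelic → ℂ)) (_ : FiniteDimensional ℂ ↥V)
      (_ : ∀ k ∈ ((standardMaximalCompactGL 3 L).comap (adelicVal (↥(maximalRealSubfield L)) L (IsCMField.complexConj L) 3 ((StdForm.antidiagonal 3).over L)) : Subgroup (quasiSplit (↥(maximalRealSubfield L)) L (IsCMField.complexConj L) 3).Adelic), ∀ ψ ∈ V, (fun x => ψ (x * k)) ∈ V) (_ : ∀ ψ ∈ V, IsChiSectionPair (ξ.bcη⁻¹ * ξ.bcψ⁻¹ * μω) ξ.ψ ψ) (_ : ∀ ψ ∈ V, Continuous ψ)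
      (_ : ∀ ψ ∈ V, ∃ M : ℝ, ∀ x, ‖ψ x‖ ≤ M) (_ : V ≤ chiSectionSpacePair (ξ.bcη⁻¹ * ξ.bcψ⁻¹ * μω) ξ.ψ (tauLevel L U₀) ((1 : ↥(tauLevel L U₀) →* ℂ) : ↥(tauLevel L U₀) → ℂ))
      (_ : ∃ hV : ∀ k : ↥((standardMaximalCompactGL 3 L).comap (adelicVal (↥(maximalRealSubfield L)) L (IsCMField.complexConj L) 3 ((StdForm.antidiagonal 3).over L)) : Subgroup (quasiSplit (↥(maximalRealSubfield L)) L (IsCMField.complexConj L) 3).Adelic), ∀ ψ ∈ V, ((rightTranslation (quasiSplit (↥(maximalRealSubfield L)) L (IsCMField.complexConj L) 3)).comp ((standardMaximalCompactGL 3 L).comap (adelicVal (↥(maximalRealSubfield L)) L (IsCMField.complexConj L) 3 ((StdForm.antidiagonal 3).over L)) : Subgroup (quasiSplit (↥(maximalRealSubfield L)) L (IsCMField.complexConj L) 3).Adelic).subtype) k ψ ∈ V, (Subrepresentation.toRepresentation (⟨V, hV⟩ : Subrepresentation ((rightTranslation (quasiSplit (↥(maximalRealSubfield L)) L (IsCMField.complexConj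 L) 3)).comp ((standardMaximalCompactGL 3 L).comap (adelicVal (↥(maximalRealSubfield L)) L (IsCMField.complexConj L) 3 ((StdForm.antidiagonal 3).over L)) : Subgroup (quasiSplit (↥(maximalRealSubfield L)) L (IsCMField.complexConj L) 3).Adelic).subtype))).IsIrreducible)
      (_ : ∃ (W₀ : Submodule ℂ ((quasiSplit (↥(maximalRealSubfield L)) L (IsCMField.complexConj L) 3).Adelic → ℂ)) (hW₀K : ∀ k : ↥(archMaximalCompact L), ∀ ψ ∈ W₀, ((rightTranslation (quasiSplit (↥(maximalRealSubfield L)) L (IsCMField.complexConj L) 3)).comp (archMaximalCompact L).subtype) k ψ ∈ W₀),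
        FiniteDimensional ℂ ↥W₀ ∧ (Subrepresentation.toRepresentation (⟨W₀, hW₀K⟩ : Subrepresentation ((rightTranslation (quasiSplit (↥(maximalRealSubfield L)) L (IsCMField.complexConj L) 3)).comp (archMaximalCompact L).subtype))).IsIrreducible ∧
        V ≤ chiSectionSpacePairKType (ξ.bcη⁻¹ * ξ.bcψ⁻¹ * μω) ξ.ψ (tauLevel L U₀) ((1 : ↥(tauLevel L U₀) →* ℂ) : ↥(tauLevel L U₀) → ℂ) (archMaximalCompact L).subtype (commute_tauLevel_archMaximalCompact L U₀) (Subrepresentation.toRepresentation (⟨W₀, hW₀K⟩ : Subrepresentation ((rightTranslation (quasiSplit (↥(maximalRealSubfield L)) L (IsCMField.complexConj L) 3)).comp (archMaximalCompact L).subtype))))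
      (ν : Measure ↥(adelicUnipotent (↥(maximalRealSubfield L)) L (IsCMField.complexConj L) 3)) (_ : ν.IsHaarMeasure) (𝓕 : Set ↥(adelicUnipotent (↥(maximalRealSubfield L)) L (IsCMField.complexConj L) 3))
      (_ : IsFundamentalDomain ↥(rationalUnipotent (↥(maximalRealSubfield L)) L (IsCMField.complexConj L) 3) 𝓕 ν) (_ : IsCompact (closure 𝓕)) (_ : ν.IsInvInvariant) (_ : ν 𝓕 = 1),
      ∀ φ ∈ V, ∃ (Ec' : ℂ → (quasiSplit (↥(maximalRealSubfield L)) L (IsCMField.complexConj L) 3).Adelic → ℂ) (P : Set ℂ), IsClosed P ∧ (∀ z₀ : ℂ, ∀ᶠ s in 𝓝[≠] z₀, s ∉ P) ∧ (∀ z ∈ P, z.re ≤ 2) ∧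
        (∀ z : ℂ, 2 < z.re → Ec' z = eisensteinSeriesU (flatSectionU φ z)) ∧ (∀ g (z : ℂ), z ∉ P → AnalyticAt ℂ (fun z => Ec' z g) z) ∧
        (∀ z : ℂ, z ∉ P → Continuous (Ec' z)) ∧
        (∀ z₁ : ℂ, z₁ ∉ P → ∀ K : Set (quasiSplit (↥(maximalRealSubfield L)) L (IsCMField.complexConj L) 3).Adelic, IsCompact K → ∃ V ∈ 𝓝 z₁, ∃ M : ℝ, ∀ z ∈ V, ∀ g ∈ K, ‖Ec' z g‖ ≤ M) ∧
        (∀ T : ℝ≥0, 1 ≤ T → ∃ Fam : ℂ → Lp ℂ 2 μ, DifferentiableOn ℂ Fam Pᶜ ∧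
          ∀ z : ℂ, z ∉ P → ((Fam z : Lp ℂ 2 μ) : (quasiSplit (↥(maximalRealSubfield L)) L (IsCMField.complexConj L) 3).automorphicQuotient → ℂ) =ᵐ[μ]
            (quasiSplit (↥(maximalRealSubfield L)) L (IsCMField.complexConj L) 3).quotFun (truncation ν 𝓕 T (Ec' z))) := by
  classical
  intro U₀ hU₀ V hVfd hVK hVχ hVc hVM hVlev hVirr _ ν hν 𝓕 h𝓕N h𝓕c hνi hν1 φ hφ
  haveI := hVfd
  haveI := hν
  haveI := hνi
  haveI : ν.IsMulRightInvariant := by rw [← Measure.inv_eq_self ν]; infer_instance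
  have h𝓕₀ : ν 𝓕 ≠ 0 := by rw [hν1]; exact one_ne_zero
  obtain ⟨hV, hirrV⟩ := hVirr
  -- the internal `W`-isotypy of the `K_max`-irreducible block (★ FILE A §A1), keeping `W₀ ≤ V`
  obtain ⟨W₀, hW₀K, hW₀V, hW₀fd, hirr₀, hVτ⟩ := exists_isotypy_of_kMax_irreducible L V hV hirrV
  haveI := hW₀fd
  -- the archimedean left law (★ FILE A §A2) and the `GL₃(𝔸_f)`-level (★ FILE A §A3)
  obtain ⟨cB, hVB, hcBz, hcB0⟩ := exists_archBorelLaw L (V := V) hVχ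
  obtain ⟨U₀', hU₀o, hU₀c, hU₀K, hsub⟩ := exists_GLlevel_of_isTauLevel L hU₀
  have hVU := hVU_of_le_tauLevel L hVlev hsub
  -- the co-weight line for this `τ₀` (members of `W₀ ≤ V` are continuous pair-sections), in the ports' spelling
  obtain ⟨l₀, hl₀⟩ := hCO W₀ hW₀K hW₀fd (fun ψ hψ => hVχ ψ (hW₀V hψ)) (fun ψ hψ => hVc ψ (hW₀V hψ)) hirr₀
  have hco : ∃ l₀ : ↥W₀ →ₗ[ℂ] ℂ, ∀ l : ↥W₀ →ₗ[ℂ] ℂ,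
      (∀ m ∈ (borelAdelic (↥(maximalRealSubfield L)) L (IsCMField.complexConj L) 3).comap (archToAdelic (↥(maximalRealSubfield L)) L (IsCMField.complexConj L) 3 ((StdForm.antidiagonal 3).over L)), m ∈ (((standardMaximalCompactGL 3 L).comap (adelicVal (↥(maximalRealSubfield L)) L (IsCMField.complexConj L) 3 ((StdForm.antidiagonal 3).over L)) : Subgroup (quasiSplit (↥(maximalRealSubfield L)) L (IsCMField.complexConj L) 3).Adelic)).comap (archToAdelic (↥(maximalRealSubfield L)) L (IsCMField.complexConj L) 3 ((StdForm.antidiagonal 3).over L)) →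
        ∀ w, l ((fun a : ↥(arch (↥(maximalRealSubfield L)) L (IsCMField.complexConj L) 3 ((StdForm.antidiagonal 3).over L)) => if h : (adelicVal (↥(maximalRealSubfield L)) L (IsCMField.complexConj L) 3 ((StdForm.antidiagonal 3).over L)) ((archToAdelic (↥(maximalRealSubfield L)) L (IsCMField.complexConj L) 3 ((StdForm.antidiagonal 3).over L)) a) ∈ standardMaximalCompactGL 3 L then (Subrepresentation.toRepresentation (⟨W₀, hW₀K⟩ : Subrepresentation ((rightTranslation (quasiSplit (↥(maximalRealSubfield L)) L (IsCMField.complexConj L) 3)).comp (archMaximalCompact L).subtype))) ⟨(archToAdelic (↥(maximalRealSubfield L)) L (IsCMField.complexConj L) 3 ((StdForm.antidiagonal 3).over L)) a, archToAdelic_mem_archMaximalCompact L a h⟩ else LinearMap.id) m w) = cB 0 m * l w) →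
      ∃ a : ℂ, l = a • l₀ := by
    refine ⟨l₀, fun l hl => hl₀ l fun m hmB hmK w => ?_⟩
    have h := hl m hmB hmK w
    dsimp only at h
    rwa [dif_pos hmK, hcB0 m hmB hmK] at h
  -- the K-finite exports-with-(E6) head with both τ-ports, projected to the eight clauses
  obtain ⟨n, φ', q, Ec, qc, P, -, -, -, -, -, -, -, -, hE2, -, hPc, hPcd, hPre, hEan, -, -, -, hE4, hEbd, hE6⟩ :=
    chiEisenstein_meromorphic_exports_kfinite_with_truncatedFamily_of_ports_of_coweightLine L (μ := μ) (νG := νG) (ν := ν) h𝓕N h𝓕c h𝓕₀ hβ hμZ μa μf ξ.hψ V hVK hVχ hVc hVM U₀' hU₀o hU₀c hU₀K hVU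
      (fun a : ↥(arch (↥(maximalRealSubfield L)) L (IsCMField.complexConj L) 3 ((StdForm.antidiagonal 3).over L)) => if h : (adelicVal (↥(maximalRealSubfield L)) L (IsCMField.complexConj L) 3 ((StdForm.antidiagonal 3).over L)) ((archToAdelic (↥(maximalRealSubfield L)) L (IsCMField.complexConj L) 3 ((StdForm.antidiagonal 3).over L)) a) ∈ standardMaximalCompactGL 3 L then (Subrepresentation.toRepresentation (⟨W₀, hW₀K⟩ : Subrepresentation ((rightTranslation (quasiSplit (↥(maximalRealSubfield L)) L (IsCMField.complexConj L) 3)).comp (archMaximalCompact L).subtype))) ⟨(archToAdelic (↥(maximalRealSubfield L)) L (IsCMField.complexConj L) 3 ((StdForm.antidiagonal 3).over L)) a, archToAdelic_mem_archMaximalCompact L a h⟩ else LinearMap.id)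
      cB hVB hVτ (cB 0) hcBz hco hφ
  exact ⟨Ec, P, hPc, hPcd, hPre, hE2, hEan, hE4, hEbd, hE6⟩

/-! ## §3 HEAD: the exports-with-(E6) τ-row `hTEXP6` OF PORTS -/

include hβ hμZ μa μf in
/-- **§3 HEAD — `hTEXP6_row_of_ports`**: ★ p864638 §3 `hCONT_tauRow_of_truncatedExportsRow`'s hypothesis `hTEXP6` at the `φ_ξ`-block — exports WITH the truncated `L²` family at EVERY
`K_∞`-finite τ-admissible generator `(U₀, φ)` and every normalised Heisenberg package — BYTE FOR BYTE, from `hμu` (★ `isUnitary_blockChar`, ★ `norm_eta∕psi_apply_eq_one`, ★ `hSUM_of_unitary`),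
the frame (F)(F′) and the restricted co-weight line letter `hCO′` (★ FILE 1 `truncatedExportsTauRow_of_pureBlocks` ∘ §2).  This is also K2E2-p12 (g10)'s (R)′ V2 per-generator binder.
[cite: MoeglinWaldspurger1995, II.1.5, IV.1.9–IV.1.11, IV.2.3] [cite: BernsteinLapid2019, Thm 2.3, §4] [cite: Rogawski1990, §13.9 p. 229 (ii)] -/
theorem hTEXP6_row_of_ports (hμu : μω.IsUnitary)
    (hCO : ∀ (W₀ : Submodule ℂ ((quasiSplit (↥(maximalRealSubfield L)) L (IsCMField.complexConj L) 3).Adelic → ℂ)) (hW₀K : ∀ k : ↥(archMaximalCompact L), ∀ ψ ∈ W₀, ((rightTranslation (quasiSplit (↥(maximalRealSubfield L)) L (IsCMField.complexConj L) 3)).comp (archMaximalCompact L).subtype) k ψ ∈ W₀) (_ : FiniteDimensional ℂ ↥W₀)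
      (_ : ∀ ψ ∈ W₀, IsChiSectionPair (ξ.bcη⁻¹ * ξ.bcψ⁻¹ * μω) ξ.ψ ψ) (_ : ∀ ψ ∈ W₀, Continuous ψ) (_ : (Subrepresentation.toRepresentation (⟨W₀, hW₀K⟩ : Subrepresentation ((rightTranslation (quasiSplit (↥(maximalRealSubfield L)) L (IsCMField.complexConj L) 3)).comp (archMaximalCompact L).subtype))).IsIrreducible),
      ∃ l₀ : ↥W₀ →ₗ[ℂ] ℂ, ∀ l : ↥W₀ →ₗ[ℂ] ℂ,
        (∀ (m : ↥(arch (↥(maximalRealSubfield L)) L (IsCMField.complexConj L) 3 ((StdForm.antidiagonal 3).over L))) (hmB : (archToAdelic (↥(maximalRealSubfield L)) L (IsCMField.complexConj L) 3 ((StdForm.antidiagonal 3).over L)) m ∈ borelAdelic (↥(maximalRealSubfield L)) L (IsCMField.complexConj L) 3) (hmK : (adelicVal (↥(maximalRealSubfield L)) L (IsCMField.complexConj L) 3 ((StdForm.antidiagonal 3).over L)) ((archToAdelic (↥(maximalRealSubfield L)) L (IsCMField.complexConj L) 3 ((StdForm.antidiagonal 3).over L)) m) ∈ standardMaximalCompactGL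 3 L) (w : ↥W₀),
          l ((Subrepresentation.toRepresentation (⟨W₀, hW₀K⟩ : Subrepresentation ((rightTranslation (quasiSplit (↥(maximalRealSubfield L)) L (IsCMField.complexConj L) 3)).comp (archMaximalCompact L).subtype))) ⟨(archToAdelic (↥(maximalRealSubfield L)) L (IsCMField.complexConj L) 3 ((StdForm.antidiagonal 3).over L)) m, archToAdelic_mem_archMaximalCompact L m hmK⟩ w) = ((((ξ.bcη⁻¹ * ξ.bcψ⁻¹ * μω)) (firstEntryUnit hmB) : ℂˣ) : ℂ) * (((ξ.ψ) (middleEntryUnitary hmB) : ℂˣ) : ℂ) * l w) →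
        ∃ a : ℂ, l = a • l₀) :
    ∀ (U₀ : Subgroup ↥(finAdelic (↥(maximalRealSubfield L)) L (IsCMField.complexConj L) 3 ((StdForm.antidiagonal 3).over L))) (_ : IsTauLevel L U₀)
      (φ : (quasiSplit (↥(maximalRealSubfield L)) L (IsCMField.complexConj L) 3).Adelic → ℂ) (_ : φ ∈ chiSectionSpacePair (ξ.bcη⁻¹ * ξ.bcψ⁻¹ * μω) ξ.ψ (tauLevel L U₀) ((1 : ↥(tauLevel L U₀) →* ℂ) : ↥(tauLevel L U₀) → ℂ)) (_ : Continuous φ)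
      (_ : IsArchFinite L φ)
      (ν : Measure ↥(adelicUnipotent (↥(maximalRealSubfield L)) L (IsCMField.complexConj L) 3)) (_ : ν.IsHaarMeasure) (𝓕 : Set ↥(adelicUnipotent (↥(maximalRealSubfield L)) L (IsCMField.complexConj L) 3))
      (_ : IsFundamentalDomain ↥(rationalUnipotent (↥(maximalRealSubfield L)) L (IsCMField.complexConj L) 3) 𝓕 ν) (_ : IsCompact (closure 𝓕)) (_ : ν.IsInvInvariant) (_ : ν 𝓕 = 1),
      ∃ (Ec' : ℂ → (quasiSplit (↥(maximalRealSubfield L)) L (IsCMField.complexConj L) 3).Adelic → ℂ) (P : Set ℂ), IsClosed P ∧ (∀ z₀ : ℂ, ∀ᶠ s in 𝓝[≠] z₀, s ∉ P) ∧ (∀ z ∈ P, z.re ≤ 2) ∧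
        (∀ z : ℂ, 2 < z.re → Ec' z = eisensteinSeriesU (flatSectionU φ z)) ∧ (∀ g (z : ℂ), z ∉ P → AnalyticAt ℂ (fun z => Ec' z g) z) ∧
        (∀ z : ℂ, z ∉ P → Continuous (Ec' z)) ∧
        (∀ z₁ : ℂ, z₁ ∉ P → ∀ K : Set (quasiSplit (↥(maximalRealSubfield L)) L (IsCMField.complexConj L) 3).Adelic, IsCompact K → ∃ V ∈ 𝓝 z₁, ∃ M : ℝ, ∀ z ∈ V, ∀ g ∈ K, ‖Ec' z g‖ ≤ M) ∧
        (∀ T : ℝ≥0, 1 ≤ T → ∃ Fam : ℂ → Lp ℂ 2 μ, DifferentiableOn ℂ Fam Pᶜ ∧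
          ∀ z : ℂ, z ∉ P → ((Fam z : Lp ℂ 2 μ) : (quasiSplit (↥(maximalRealSubfield L)) L (IsCMField.complexConj L) 3).automorphicQuotient → ℂ) =ᵐ[μ]
            (quasiSplit (↥(maximalRealSubfield L)) L (IsCMField.complexConj L) 3).quotFun (truncation ν 𝓕 T (Ec' z))) :=
  truncatedExportsTauRow_of_pureBlocks L μ ξ μω (isUnitary_blockChar L ξ μω hμu (norm_eta_apply_eq_one L ξ) (norm_psi_apply_eq_one L ξ)) (norm_psi_apply_eq_one L ξ)
    (hSUM_of_unitary L ξ μω hμu (norm_eta_apply_eq_one L ξ) (norm_psi_apply_eq_one L ξ))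
    (hPURE6_of_coweightLines' L μ νG hβ hμZ μa μf ξ μω hCO)

/-! ## §4 (R)′'s `hCONT` τ-row off the gauge road -/

include hβ hμZ μa μf in
/-- **§4 — `hCONT_tauRow_of_ports`**: the `hCONT` binder of ★ p864188 `res_midBlock_le_residual_of_tauAdmissible` (:77–:89) at the `φ_ξ`-block, BYTE FOR BYTE — the Maass–Selberg
continuation of the truncated family of EVERY τ-admissible generator datum on its own slit plane (`T := 1`, `S := ∅` inside) — from `hμu`, the frame (F)(F′) and `hCO′` ALONE: ★ p864638 §3
`hCONT_tauRow_of_truncatedExportsRow` ∘ §3.  NO gauge letter, NO ledger, NO Maass–Selberg letter. [cite: MoeglinWaldspurger1995, IV.1.11, IV.2.3, V.3.13] [cite: BernsteinLapid2019, Thm 2.3, §4]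
[cite: Rogawski1990, §13.9 p. 229 (ii)] -/
theorem hCONT_tauRow_of_ports (hμu : μω.IsUnitary)
    (hCO : ∀ (W₀ : Submodule ℂ ((quasiSplit (↥(maximalRealSubfield L)) L (IsCMField.complexConj L) 3).Adelic → ℂ)) (hW₀K : ∀ k : ↥(archMaximalCompact L), ∀ ψ ∈ W₀, ((rightTranslation (quasiSplit (↥(maximalRealSubfield L)) L (IsCMField.complexConj L) 3)).comp (archMaximalCompact L).subtype) k ψ ∈ W₀) (_ : FiniteDimensional ℂ ↥W₀)
      (_ : ∀ ψ ∈ W₀, IsChiSectionPair (ξ.bcη⁻¹ * ξ.bcψ⁻¹ * μω) ξ.ψ ψ) (_ : ∀ ψ ∈ W₀, Continuous ψ) (_ : (Subrepresentation.toRepresentation (⟨W₀, hW₀K⟩ : Subrepresentation ((rightTranslation (quasiSplit (↥(maximalRealSubfield L)) L (IsCMField.complexConj L) 3)).comp (archMaximalCompact L).subtype))).IsIrreducible),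
      ∃ l₀ : ↥W₀ →ₗ[ℂ] ℂ, ∀ l : ↥W₀ →ₗ[ℂ] ℂ,
        (∀ (m : ↥(arch (↥(maximalRealSubfield L)) L (IsCMField.complexConj L) 3 ((StdForm.antidiagonal 3).over L))) (hmB : (archToAdelic (↥(maximalRealSubfield L)) L (IsCMField.complexConj L) 3 ((StdForm.antidiagonal 3).over L)) m ∈ borelAdelic (↥(maximalRealSubfield L)) L (IsCMField.complexConj L) 3) (hmK : (adelicVal (↥(maximalRealSubfield L)) L (IsCMField.complexConj L) 3 ((StdForm.antidiagonal 3).over L)) ((archToAdelic (↥(maximalRealSubfield L)) L (IsCMField.complexConj L) 3 ((StdForm.antidiagonal 3).over L)) m) ∈ standardMaximalCompactGL 3 L) (w : ↥W₀),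
          l ((Subrepresentation.toRepresentation (⟨W₀, hW₀K⟩ : Subrepresentation ((rightTranslation (quasiSplit (↥(maximalRealSubfield L)) L (IsCMField.complexConj L) 3)).comp (archMaximalCompact L).subtype))) ⟨(archToAdelic (↥(maximalRealSubfield L)) L (IsCMField.complexConj L) 3 ((StdForm.antidiagonal 3).over L)) m, archToAdelic_mem_archMaximalCompact L m hmK⟩ w) = ((((ξ.bcη⁻¹ * ξ.bcψ⁻¹ * μω)) (firstEntryUnit hmB) : ℂˣ) : ℂ) * (((ξ.ψ) (middleEntryUnitary hmB) : ℂˣ) : ℂ) * l w) →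
        ∃ a : ℂ, l = a • l₀) :
    ∀ (U₀ : Subgroup ↥(finAdelic (↥(maximalRealSubfield L)) L (IsCMField.complexConj L) 3 ((StdForm.antidiagonal 3).over L))) (_ : IsTauLevel L U₀)
      (φ : (quasiSplit (↥(maximalRealSubfield L)) L (IsCMField.complexConj L) 3).Adelic → ℂ) (_ : φ ∈ chiSectionSpacePair (ξ.bcη⁻¹ * ξ.bcψ⁻¹ * μω) ξ.ψ (tauLevel L U₀) ((1 : ↥(tauLevel L U₀) →* ℂ) : ↥(tauLevel L U₀) → ℂ)) (_ : Continuous φ)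
      (_ : IsArchFinite L φ)
      (Ec : ℂ → (quasiSplit (↥(maximalRealSubfield L)) L (IsCMField.complexConj L) 3).Adelic → ℂ) (Sp : Finset ℂ) (_ : ∀ s ∈ Sp, s.im = 0 ∧ 1 < s.re ∧ s.re ≤ 2)
      (_ : ∀ g, DifferentiableOn ℂ (fun z => Ec z g) ({z : ℂ | 1 < z.re} \ (↑Sp : Set ℂ)))
      (_ : ∀ z : ℂ, 2 < z.re → Ec z = eisensteinSeriesU (flatSectionU φ z))
      (Fp : (quasiSplit (↥(maximalRealSubfield L)) L (IsCMField.complexConj L) 3).Adelic → ℂ → ℂ) (_ : ∀ g, AnalyticAt ℂ (Fp g) ((3 : ℂ) / 2))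
      (_ : ∀ g, Fp g =ᶠ[𝓝[≠] ((3 : ℂ) / 2)] fun z => (z - (3 : ℂ) / 2) * Ec z g)
      (f : (quasiSplit (↥(maximalRealSubfield L)) L (IsCMField.complexConj L) 3).L2 μ) (_ : (f : (quasiSplit (↥(maximalRealSubfield L)) L (IsCMField.complexConj L) 3).automorphicQuotient → ℂ) =ᵐ[μ] fun x => Fp (Quotient.out (x : (quasiSplit (↥(maximalRealSubfield L)) L (IsCMField.complexConj L) 3).Adelic ⧸ (quasiSplit (↥(maximalRealSubfield L)) L (IsCMField.complexConj L) 3).quotientSubgroup))⁻¹ ((3 : ℂ) / 2))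
      (ν : Measure ↥(adelicUnipotent (↥(maximalRealSubfield L)) L (IsCMField.complexConj L) 3)) (_ : ν.IsHaarMeasure) (𝓕 : Set ↥(adelicUnipotent (↥(maximalRealSubfield L)) L (IsCMField.complexConj L) 3))
      (_ : IsFundamentalDomain ↥(rationalUnipotent (↥(maximalRealSubfield L)) L (IsCMField.complexConj L) 3) 𝓕 ν) (_ : IsCompact (closure 𝓕)) (_ : ν.IsInvInvariant) (_ : ν 𝓕 = 1),
      ∃ (T : ℝ≥0) (_ : 1 ≤ T) (S : Finset ℂ) (_ : ∀ s ∈ S, s.im = 0) (Fam : ℂ → (quasiSplit (↥(maximalRealSubfield L)) L (IsCMField.complexConj L) 3).L2 μ),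
        DifferentiableOn ℂ Fam ({z : ℂ | 1 < z.re} \ (↑(Sp ∪ S) : Set ℂ)) ∧
        ∀ z ∈ ({z : ℂ | 1 < z.re} \ (↑(Sp ∪ S) : Set ℂ)), ((Fam z : (quasiSplit (↥(maximalRealSubfield L)) L (IsCMField.complexConj L) 3).L2 μ) : (quasiSplit (↥(maximalRealSubfield L)) L (IsCMField.complexConj L) 3).automorphicQuotient → ℂ) =ᵐ[μ] (quasiSplit (↥(maximalRealSubfield L)) L (IsCMField.complexConj L) 3).quotFun (truncation ν 𝓕 T (Ec z)) :=
  hCONT_tauRow_of_truncatedExportsRow L μ ξ.hψ (hTEXP6_row_of_ports L μ νG hβ hμZ μa μf ξ μω hμu hCO)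

end Row

end Summit.HodgeConjecture.HodgeConjecture.R90.S8

end
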